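import Summits.BirchSwinnertonDyer.BirchSwinnertonDyer.Theses.GenusKolyvaginAtTwo
import Summits.BirchSwinnertonDyer.BirchSwinnertonDyer.Theses.ByReductionTypeAtTwo
import Summits.BirchSwinnertonDyer.BirchSwinnertonDyer.Theorems.GenusKolyvaginAtTwoK4NegPhantomCellHalvingBit
import Summits.BirchSwinnertonDyer.BirchSwinnertonDyer.Theorems.GenusKolyvaginAtTwoGenusDeepSupplyAtTwoNegDiscNarrowOfKernelsPrime
import Summits.BirchSwinnertonDyer.BirchSwinnertonDyer.Theorems.GenusKolyvaginAtTwoGenusPrimitiveSupplyAtTwoTwistingPrime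
import Summits.BirchSwinnertonDyer.BirchSwinnertonDyer.Theorems.GenusKolyvaginAtTwoGenusPrimitiveSupplyAtTwoTwistingPrimeEntangledCriterion
import Summits.BirchSwinnertonDyer.BirchSwinnertonDyer.Theorems.GenusKolyvaginAtTwoK4NegPhantomCellDescentBitFrames
import Summits.BirchSwinnertonDyer.BirchSwinnertonDyer.Theorems.GenusKolyvaginAtTwoK4NegOfWallRowsU2AlphaOrNonPhantom
import HarnessLib

/-!
# LINE 38 «steered_supply» — crux `GenusDeepSupplyAtTwoNegDiscNarrow` (stmt-BirchSwinnertonDyer-23491), route `GenusKolyvaginAtTwo` rev 59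

Ideator seat `bsd-idea-1` g28 (pen of the route).  **v1.3 — SORRY-FREE REDUCTION.**  A kernel-checked composition
`genusDeepSupplyAtTwoNegDiscNarrow_of_steeredSupply` concluding the crux BY NAME from OPEN ROUTE ITEMS ONLY (no `sorry`, no stub):
**crux 23491 ⟸ GZ (24148) + Mod (19382) + 2-parity (23327) + CONV₂ (19220) + CONV₂′ (24948) + K₁⁻ (`K1Neg`, 31525) + WALL row 1 (19095–19098) +
U₂ (22985) + Q2 (24880) + PRINT (`MultPublishedInputsAtTwo`, `EntireLFunctionRat`, `MilneAnyModel`).**  K₄⁻ (`K4Neg`, 31526) is NOT among them.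
**No summit is proved by a line.  BSD is NOT proved by this file; crux 23491 is NOT closed by it (its hypotheses are OPEN route items);
K₄⁻ is NOT proved and is NOT USED.**

## THE MOVE (one sentence)
The deciding Δ<0 crux is an `∃ K` statement, and its split glue (p-`OfKernelsMixed`) feeds it the `∀`-frame kernel `K4Neg`, whose only
engine-less habitat is the PHANTOM-TWIN half `𝒫` = «`ξ_E ∈ Sel₂(E)` ∧ `loc_(ℓ₀) ξ_E = 0`» (LINE 37 card; LEAD-BRIEF-g28 §3; gk2-p4 g34
`…K4NegPhantomFrameEntangledIffTrace`: `𝒫 ⟺ ξ_E ∈ Sel₂(E) ∧ 4 ∣ a_(ℓ₀)(E)`).  STEER THE SUPPLY AWAY FROM `𝒫`: choose the twisting prime `ℓ₀`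
of the prime Heegner field by gk2-p3 g34's (α)-prime supply `PhantomDescentBit.exists_levelFour_phantom_twistingPrime` for the Lawson–Wuthrich
class `ξ_E` (on the phantom cell; any Cor-3.4(i) lowering prime otherwise).  Then the frame carries the STEERING CURRENCY
(S1's new output clause: «bit-TRUE» ∨ «(α) Galois datum at ℓ₀», inlined — no `def : Prop`), the twin is `Sel₂`-minimal for free (`ξ_E` is a non-strict Selmer class), and the LEAD g29's landed
frame closers `PlusDescent.kFourNeg_conclusion_of_wallRows_U2_of_forall_phantom_notMem_selmerGroup` / `…_of_alive`
(`…K4NegOfWallRowsU2AlphaOrNonPhantom` §3/§4, p-landed 21:44Z) deliver K₄⁻'s CONCLUSION at that frame from WALL row 1 + U₂ + Q2 + PRINT.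
CONSEQUENCE (kernel-checked below): the `𝒫` residual of K₄⁻ — the (β)-frames `4 ∣ a_(ℓ₀)` where `hHalf` FAILS — is NEVER NEEDED for crux 23491.

## History: v1.0 (stubs S1, H) → v1.1 (H = H_ℚ PROVED + H₂) → v1.2 (S1 PROVED; one stub H₂) → v1.3 (H₂ BYPASSED by the LEAD g29's (α)/bit
closers; NO stub, NO `def : Prop`).  v1.2's twin-side dictionary (`SteerAt`, H_ℚ `twinHalf_moved_of_steer`, PROVED; tree 87131109ee02) is
superseded and dropped from this file.
* S1 `steeredPrimeTwinSupply` — PROVED: stub A‴ of the line of record (`PrimeFrame.stubA_prime_of_items`, from Mod ∧ Par ∧ CONV₂ ∧ CONV₂′) with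
  the extra output clause «bit-TRUE ∨ (α) datum at `ℓ₀ = −d_K`» (assembly of gk2-p3 g34's (α)-prime supply + gk2-p5's Cor-3.4(i) twin
  `GenusKolyTwin.supply_DEF1_of_not_strict_prime` + `HabitatCutStubA` bookkeeping; off the cell gk2-p5's old supply + uniqueness of the dying class).

## Trace dictionary (card §2; brute-force certificate `line38/h1check.py`; in the tree as gk2-p4 g34 p789093 + `…EntangledIffTrace`)
On every admissible frame (`Δ_E < 0`, `ℓ₀ ≡ 7 (8)` Heegner prime, `ρ_(E,4)` onto) `Frob_(ℓ₀)` is a transposition on `E[2]` (`(Δ/ℓ₀) = −1`;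
also forced by Kramer parity), and `loc_(ℓ₀) ξ_E = 0 ⟺ a_(ℓ₀)(E) ≡ 0 (mod 4) ⟺ Frob_(ℓ₀)` has order `2` (not `4`) in `Gal(ℚ(E[4])/ℚ)`.
So the (α) disjunct of the steering currency = «`a_(ℓ₀)(E) ≡ 2 (mod 4)`» on the phantom cell, a Čebotarev class of density `1/2` among admissible `ℓ₀`
(the LEAD g29's §5 `kFourNeg_conclusion_of_wallRows_U2_of_not_four_dvd_frobeniusTrace` is the same closer in that currency).
Instrument kit j341556 (PN-split): habitat rows 90828u1@23 (`a = −6`, `𝒩`) and 47628e1@47 (`a = −12`, `𝒫`) agree.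

References: [MazurRubin2010] Lemma 2.10–2.11, Prop. 3.3, Cor. 3.4 (i), Lemma 3.5; [Kramer1981] Thm. 1, Prop. 7; [LawsonWuthrich2016] §3, §7.1;
[GrossLMS1991] §3 (3.5), §4 (4.1), §9 Prop. 9.6; [GrossZagier1986] Thm. I.6.3; [McCallumLMS1991] §5; [WZhang2014] Thm. 1.1 (the `p ≥ 5` shape).
-/

set_option autoImplicit false
set_option linter.dupNamespace false
set_option linter.unusedVariables false

noncomputable section

open scoped Classical

namespace Summit.BirchSwinnertonDyer.BirchSwinnertonDyer.Cruxes.GenusDeepSupplyAtTwoNegDiscNarrow.SteeredSupply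

open WeierstrassCurve NumberField IsDedekindDomain Field Literature.NumberTheory.EllipticCurves
  Literature.NumberTheory.GaloisRepresentations Literature.NumberTheory.EllipticCurves.ModularForms
  Literature.NumberTheory.EllipticCurves.RingClassField
open Summit.BirchSwinnertonDyer.BirchSwinnertonDyer.Theses.GenusKolyvaginAtTwo
open Summit.BirchSwinnertonDyer.BirchSwinnertonDyer.Theorems.GenusKoly
  Summit.BirchSwinnertonDyer.BirchSwinnertonDyer.Theorems.GenusSupplyNarrow
  Summit.BirchSwinnertonDyer.BirchSwinnertonDyer.Theorems.GenusExact.PlusDescent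

/-! ## §1 S1 — the steered prime Heegner field, its narrow twin, and the steering currency (PROVED) -/

/-- **S1 — THE STEERED PRIME TWIN SUPPLY (PROVED).**  = A‴ `PrimeFrame.stubA_prime_of_items` of the line of record (Modularity ∧ 2-parity ∧
CONV₂ ∧ CONV₂′) with ONE extra output clause, the STEERING CURRENCY at `ℓ₀ = −d_K`: «every non-zero class dying on `Γ_(ℚ(E[4]))` is outside
`Sel₂(E)`» ∨ «the (α) Galois datum: a non-zero dying `ξ`, the place `v` of `ℓ₀`, a prime `𝔓₀ ∣ v` of `ℤ̄`, an arithmetic Frobenius `F` at `𝔓₀`,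
`F·F ∈ Γ_(ℚ(E[2]))`, `[ξ, F·F] ≠ 0`» — verbatim the inputs of the LEAD g29's frame closers §3/§4 of `…K4NegOfWallRowsU2AlphaOrNonPhantom`.  For `E` in the habitat with `Δ < 0` and
`#Sel₂(E) ∈ {1, 4}`: a prime Heegner field `K = ℚ(√−ℓ₀)` (`d_K = −ℓ₀` odd, `≠ −3`, Heegner for `N_E`, the two Theorem-B₂ non-squares, `2` split)
whose minimal twin `Wd ≅ E^(d_K)` has analytic rank `1`, `#Sel₂(Wd) = 2`, `ord₂ c(Wd) ≤ 1`, AND at whose prime the Selmer phantom of `E` (if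
any) is ALIVE in the (α) form.  PROOF (no new mathematics — assembly of tree theorems): ON THE PHANTOM CELL (`#Sel₂ = 4` and the Lawson–Wuthrich class Selmer)
take the (α)-prime of gk2-p3 g34 `GenusExact.PhantomDescentBit.exists_levelFour_phantom_twistingPrime` (`ℓ₀ ≡ 7 (8)`, Heegner congruences,
`loc_(ℓ₀) ξ ≠ 0`), which is a Mazur–Rubin LOWERING prime (`…not_selmerGroup_le_strictLocalKer_of_not_mem_torsionLocalKer`), feed gk2-p5's
`GenusKolyTwin.supply_DEF1_of_not_strict_prime` (Cor. 3.4 (i) = tree theorem `MazurRubin2010.cor34i_singleton_rat_holds`) and the twin bookkeeping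
of `…HabitatCutStubA` (genus budget `= 1`, no CM, `2`-torsion trivial, root number `−1` by Modularity, corank `1` by 2-parity, analytic rank `1` by
CONV₂/CONV₂′); the (α) datum is the supply's own output.  OFF THE CELL the old supply
`GenusKolyTwistingPrime.stub_minimalTwinSupplyAtTwo_genusBudget_one_of_twoConverse` stands and the curve is bit-TRUE by uniqueness of the
dying class (`GenusKolyTwistingPrime.eq_of_forall_torsionFixing_four_h1Eval_eq_zero`).
[cite: MazurRubin2010, Prop. 3.3, Cor. 3.4 (i), Lemma 3.5] [cite: Kramer1981, §2 Prop. 3] [cite: DokchitserDokchitserAnnals2010, Thm. 1.4]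
[cite: LawsonWuthrich2016, §3, §7.1] -/
theorem steeredPrimeTwinSupply (hmod : ModularityExistsNewform) (hpar : TwoParityDD) (hconv : RankOneTwoConverse)
    (hconv' : RankOneTwoConverseOffSemistableAtTwo) :
    ∀ (W : WeierstrassCurve ℚ) [W.IsElliptic] [W.IsGloballyMinimal] [NeZero (W.conductorNorm ℤ)],
    ¬ W.HasCM → W.analyticRank = 0 → (∀ n : ℕ, 0 < n → W.HasSurjectiveModNGaloisRep ((2 : ℤ) ^ n)) →
    Odd W.tamagawaProduct → W.Δ < 0 → (Nat.card (W.selmerGroup 2) = 1 ∨ Nat.card (W.selmerGroup 2) = 4) →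
    ∃ (K : Type) (_ : Field K) (_ : NumberField K),
    IsImaginaryQuadratic K ∧ Odd (NumberField.discr K) ∧ NumberField.discr K ≠ -3 ∧
    SatisfiesHeegnerHypothesis (W.conductorNorm ℤ) K ∧
    ¬ IsSquare ((NumberField.discr K : ℚ) * -|W.Δ|) ∧ ¬ IsSquare ((NumberField.discr K : ℚ) * (-(2 * |W.Δ|))) ∧
    (∃ ℓ₀ : ℕ, ∃ _ : Fact ℓ₀.Prime, NumberField.discr K = -(ℓ₀ : ℤ) ∧
      ((∀ x : galH1Torsion W (2 : ℤ), x ≠ 0 → (∀ h ∈ torsionFixing W (4 : ℤ), h1Eval W (2 : ℤ) x h = 0) → x ∉ W.selmerGroup 2) ∨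
       ∃ ξ : galH1Torsion W (2 : ℤ), ξ ≠ 0 ∧ (∀ h ∈ torsionFixing W (4 : ℤ), h1Eval W (2 : ℤ) ξ h = 0) ∧
         ∃ (v : IsDedekindDomain.HeightOneSpectrum (𝓞 ℚ)) (𝔓₀ : Ideal (absIntegers (𝓞 ℚ) ℚ)) (F : absoluteGaloisGroup ℚ),
           (Rat.HeightOneSpectrum.primesEquiv (R := 𝓞 ℚ) v : ℕ) = ℓ₀ ∧ 𝔓₀ ∈ v.primesAbove ∧ IsArithFrobAt (𝓞 ℚ) F 𝔓₀ ∧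
           F * F ∈ torsionFixing W (2 : ℤ) ∧ h1Eval W (2 : ℤ) ξ (F * F) ≠ 0)) ∧
    ((Ideal.span {(2 : ℤ)}).primesOver (NumberField.RingOfIntegers K)).ncard = 2 ∧
    ∃ (Wd : WeierstrassCurve ℚ) (_ : Wd.IsElliptic) (_ : Wd.IsGloballyMinimal),
    (∃ C : WeierstrassCurve.VariableChange ℚ, C • W.quadraticTwist (NumberField.discr K : ℚ) = Wd) ∧
    Wd.analyticRank = 1 ∧ Nat.card (Wd.selmerGroup 2) = 2 ∧ padicValNat 2 Wd.tamagawaProduct ≤ 1 := by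
  intro W _ _ _ hcm hr0 hρ hT hneg h14
  have hsurj : W.HasSurjectiveModNGaloisRep 2 := by simpa using hρ 1 one_pos
  have hsurj4 : W.HasSurjectiveModNGaloisRep 4 := by
    have h := hρ 2 two_pos
    norm_num at h
    exact h
  have hc : ∀ (V : WeierstrassCurve ℚ) [V.IsElliptic] [V.IsGloballyMinimal],
      ¬ V.HasCM → V.selmerCorank 2 = 1 → V.analyticRank = 1 := fun V _ _ hV hco ↦ by
    by_cases h : (Rank1Residual.GoodOrd V 2 ∨ Rank1Residual.Mult V 2)
    · exact hconv V hV h hco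
    · exact hconv' V hV h hco
  have huniq : ∀ {x y : galH1Torsion W (2 : ℤ)}, x ≠ 0 → y ≠ 0 →
      (∀ h ∈ torsionFixing W (4 : ℤ), h1Eval W (2 : ℤ) x h = 0) → (∀ h ∈ torsionFixing W (4 : ℤ), h1Eval W (2 : ℤ) y h = 0) → x = y :=
    fun hx0 hy0 hx hy ↦
      Summit.BirchSwinnertonDyer.BirchSwinnertonDyer.Theorems.GenusKolyTwistingPrime.eq_of_forall_torsionFixing_four_h1Eval_eq_zero W hsurj hsurj4 hx0 hy0 hx hy
  by_cases hA : Nat.card (W.selmerGroup 2) = 4 ∧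
      ∀ ξ : galH1Torsion W (2 : ℤ), ξ ≠ 0 → (∀ h ∈ torsionFixing W (4 : ℤ), h1Eval W (2 : ℤ) ξ h = 0) → ξ ∈ W.selmerGroup 2
  · -- THE PHANTOM CELL: steer the twisting prime by gk2-p3 g34's (α)-prime supply
    obtain ⟨h4, hcell⟩ := hA
    have hN : W.conductorNorm ℤ ≠ 0 := NeZero.ne _
    obtain ⟨c₀, hc₀⟩ := exists_isComplexConjugation (Rat.castHom ℝ)
    obtain ⟨ξ, hξ0, hξ4, hsup⟩ :=
      Summit.BirchSwinnertonDyer.BirchSwinnertonDyer.Theorems.GenusExact.PhantomDescentBit.exists_levelFour_phantom_twistingPrime W hsurj4 hsurj hneg hc₀ hN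
    obtain ⟨ℓ, hℓF, -, -, hℓ8, hℓp, ⟨v, 𝔓, F, hv, -, h𝔓, hF, -, hF2, hval⟩, hloc⟩ := hsup 0
    have hℓ : ℓ.Prime := hℓF.out
    have hns : ¬ W.selmerGroup 2 ≤ MazurRubin2010.strictLocalKer W ℚ_[ℓ] 2 :=
      Summit.BirchSwinnertonDyer.BirchSwinnertonDyer.Theorems.GenusExact.PhantomDescentBit.not_selmerGroup_le_strictLocalKer_of_not_mem_torsionLocalKer W (hcell ξ hξ0 hξ4) hloc
    have hℓN' : ∀ p : ℕ, p.Prime → p ∣ W.conductorNorm ℤ → p ≠ 2 → (ℓ : ZMod p) = -1 := by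
      intro p _ hp _
      have h : ((ℓ + 1 : ℕ) : ZMod p) = 0 := (ZMod.natCast_eq_zero_iff _ _).mpr (hℓp p hp)
      rw [Nat.cast_add, Nat.cast_one] at h
      exact eq_neg_of_add_eq_zero_left h
    obtain ⟨K, _, _, hK, hd, hodd, hd3, hH, hsq1, hsq2, h2K, -, Wd, _, _, hWd, hSelWd⟩ :=
      Summit.BirchSwinnertonDyer.BirchSwinnertonDyer.Theorems.GenusKolyTwin.supply_DEF1_of_not_strict_prime W MazurRubin2010.cor34i_singleton_rat_holds hneg h4 hℓ8 hℓN' hns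
    -- the twin's clauses, verbatim from `…HabitatCutStubA`
    have hprime : (NumberField.discr K).natAbs.Prime := by
      rw [hd, Int.natAbs_neg, Int.natAbs_natCast]
      exact hℓ
    obtain ⟨Cd, hCd⟩ := hWd
    have hB : padicValNat 2 Wd.tamagawaProduct = 1 :=
      Summit.BirchSwinnertonDyer.BirchSwinnertonDyer.Theorems.GenusExact.PlusDescent.padicValNat_two_tamagawaProduct_twin_eq_one_of_prime W hK hodd hH hT hneg hprime Cd hCd
    have hdQ : (NumberField.discr K : ℚ) ≠ 0 := by exact_mod_cast NumberField.discr_ne_zero K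
    have hcmd : ¬ Wd.HasCM := Summit.BirchSwinnertonDyer.BirchSwinnertonDyer.Theorems.GenusKoly.twin_not_hasCM W hcm hdQ Wd ⟨Cd, hCd⟩
    have htors := Summit.BirchSwinnertonDyer.BirchSwinnertonDyer.Theorems.GenusKoly.natCard_twoTorsion_twin_eq_one W (hρ 1 one_pos) hdQ Wd ⟨Cd, hCd⟩
    have hw := Summit.BirchSwinnertonDyer.BirchSwinnertonDyer.Theorems.GenusKoly.rootNumber_twin_eq_neg_one hmod W hr0 K hK hH Wd ⟨Cd, hCd⟩
    have hco := Summit.BirchSwinnertonDyer.BirchSwinnertonDyer.Theorems.GenusKoly.selmerCorank_two_eq_one_of_card_selmerGroup_two Wd htors hSelWd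
      (Summit.BirchSwinnertonDyer.BirchSwinnertonDyer.Theorems.GenusKoly.odd_selmerCorank_two_of_p_parity Wd (hpar Wd) hw)
    exact ⟨K, inferInstance, inferInstance, hK, hodd, hd3, hH, hsq1, hsq2,
      ⟨ℓ, hℓF, hd, Or.inr ⟨ξ, hξ0, hξ4, v, 𝔓, F, hv, h𝔓, hF, hF2, hval⟩⟩, h2K, Wd, inferInstance, inferInstance,
      ⟨Cd, hCd⟩, hc Wd hcmd hco, hSelWd, hB.le⟩
  · -- OFF THE PHANTOM CELL: the old supply; the curve is bit-TRUE (no non-zero dying Selmer class)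
    obtain ⟨ℓ, hℓ, -, -, K, iF, iN, hIQ, hd, hodd, h3, hHe, hsq1, hsq2, h2K, Wd, iE, iM, hWd, -, hrd, hSel, hB⟩ :=
      Summit.BirchSwinnertonDyer.BirchSwinnertonDyer.Theorems.GenusKolyTwistingPrime.stub_minimalTwinSupplyAtTwo_genusBudget_one_of_twoConverse hmod hpar hc W hcm hr0 hρ hneg hT h14
    haveI hℓF : Fact ℓ.Prime := ⟨hℓ⟩
    -- the curve is bit-TRUE: a non-zero dying Selmer class would put us on the phantom cell (uniqueness of the dying class)
    have hbit : ∀ x : galH1Torsion W (2 : ℤ), x ≠ 0 → (∀ h ∈ torsionFixing W (4 : ℤ), h1Eval W (2 : ℤ) x h = 0) →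
        x ∉ W.selmerGroup 2 := by
      intro y hy0 hyd hyS
      apply hA
      rcases h14 with h1 | h4
      · exfalso
        obtain ⟨x₀, hx₀⟩ := Nat.card_eq_one_iff_exists.mp h1
        exact hy0 (congrArg Subtype.val ((hx₀ ⟨y, hyS⟩).trans (hx₀ ⟨0, zero_mem _⟩).symm))
      · refine ⟨h4, fun ξ hξ0 hξ4 ↦ ?_⟩
        rw [huniq hξ0 hy0 hξ4 hyd]
        exact hyS
    exact ⟨K, iF, iN, hIQ, hodd, h3, hHe, hsq1, hsq2, ⟨ℓ, hℓF, hd, Or.inl hbit⟩, h2K, Wd, iE, iM, hWd, hrd, hSel, hB.le⟩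

/-! ## §2 The composition: crux 23491 BY NAME, with NO `𝒫` residual and NO stub -/

open Summit.BirchSwinnertonDyer.BirchSwinnertonDyer.Theses.ByReductionTypeAtTwo
  (GoodOrdinaryRankZeroAtTwo MultiplicativeRankZeroAtTwo SupersingularRankZeroAtTwo AdditiveRankZeroAtTwo) in
/-- **LINE 38 COMPOSITION — `GenusDeepSupplyAtTwoNegDiscNarrow` (crux 23491) BY NAME ⟸ five route items (Gross–Zagier 24148, Modularity
19382, 2-parity 23327, CONV₂ 19220, CONV₂′ 24948) + K₁⁻ (`K1Neg`, 31525) + WALL row 1 (19095–19098) + U₂ (`MinimalTwinBSDTwo`, 22985) + Q2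
(`KolyvaginRelationAtTwo`, 24880) + PRINT (`MultPublishedInputsAtTwo`, `EntireLFunctionRat`, `MilneAnyModel`) — NOTHING ELSE.**
Kernel-checked; NO `sorry` (v1.3).  The composition of the line of record (`PrimeFrame.genusDeepSupplyAtTwoNegDiscNarrow_of_
kernels_prime`, p-landed) verbatim, with A‴ ↦ S1 and, at positive depth on the `#Sel₂(E) = 4` cell, the kernel K₄′ ↦ the LEAD g29's frame
closers `kFourNeg_conclusion_of_wallRows_U2_of_forall_phantom_notMem_selmerGroup` (bit-TRUE disjunct of the steering currency) and
`kFourNeg_conclusion_of_wallRows_U2_of_alive` ((α) disjunct), both fed by WALL row 1, U₂, Q2, PRINT by name.  K₄⁻ (`K4Neg`) is not used: its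
phantom-twin half `𝒫` is avoided by the steering.  BSD is NOT proved; the crux is NOT closed (fourteen OPEN route items among the hypotheses;
no stub). [cite: GrossZagier1986, Thm. I.6.3 with V.§2] [cite: GrossLMS1991, §3 (3.5), §4 (4.1)]
[cite: MazurRubin2010, Prop. 3.3, Lemma 2.10–2.11] [cite: McCallumLMS1991, §5 Thm. 5.4] -/
theorem genusDeepSupplyAtTwoNegDiscNarrow_of_steeredSupply (hGZ : GrossZagierAllLevels) (hmod : ModularityExistsNewform)
    (hpar : TwoParityDD) (hconv : RankOneTwoConverse) (hconv' : RankOneTwoConverseOffSemistableAtTwo)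
    (hK1 : K1Neg)
    (hOrd : GoodOrdinaryRankZeroAtTwo) (hMult : MultiplicativeRankZeroAtTwo) (hSS : SupersingularRankZeroAtTwo)
    (hAdd : AdditiveRankZeroAtTwo) (hTw : MinimalTwinBSDTwo) (hQ2 : KolyvaginRelationAtTwo)
    (hGZK : MultPublishedInputsAtTwo) (hL : EntireLFunctionRat) (hMi : MilneAnyModel) :
    Summit.BirchSwinnertonDyer.BirchSwinnertonDyer.Theses.GenusKolyvaginAtTwo.GenusDeepSupplyAtTwoNegDiscNarrow := by
  intro W _ _ _ hcm hr0 hρ hT hneg hopt h14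
  -- S1: the steered prime Heegner field and the narrow twin
  obtain ⟨K, iF, iN, hIQ, hodd, h3, hHe, hsq1, hsq2, ⟨ℓ₀, iℓ₀, hdK, hAB⟩, h2K, Wd, iE, iM, hWd, hrd, hSel, hDEF⟩ :=
    steeredPrimeTwinSupply hmod hpar hconv hconv' W hcm hr0 hρ hT hneg h14
  haveI : Fact ℓ₀.Prime := iℓ₀
  obtain ⟨Dt, hoptDt, hc⟩ := hopt
  -- glue: orientation, embedding, conductor-`1` datum (line of record, verbatim)
  obtain ⟨β, hβ⟩ : ∃ β : ℤ, (4 * (W.conductorNorm ℤ : ℕ) : ℤ) ∣ β ^ 2 - NumberField.discr K :=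
    Literature.NumberTheory.QuadraticFields.Quadratic.exists_dvd_sq_sub_discr_of_ncard_primesOver hIQ.1 (NeZero.ne _) hHe
  obtain ⟨ι⟩ : Nonempty (K →+* ℂ) := inferInstance
  obtain ⟨d₁⟩ := exists_kolyvaginHeegnerData_one
    (phi_heegnerTau_mem_singularModuliField_holds (W.conductorNorm ℤ) W K) hIQ Dt β ι hβ
  -- the twin: non-CM; the analytic rank of the twist is read off its minimal model
  have hd : (NumberField.discr K : ℚ) ≠ 0 := by exact_mod_cast NumberField.discr_ne_zero K
  haveI := W.isElliptic_quadraticTwist hd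
  have hcmd : ¬ Wd.HasCM := twin_not_hasCM W hcm hd Wd hWd
  have hrtw : (W.quadraticTwist (NumberField.discr K : ℚ)).analyticRank = 1 := by
    obtain ⟨C, hC⟩ := hWd
    rw [← analyticRank_smul (W.quadraticTwist (NumberField.discr K : ℚ)) C, hC]
    exact hrd
  -- Gross–Zagier at the pair `(E, K)`: `y_K` of infinite order; McCallum's exponent
  have hy : ¬ IsOfFinAddOrder d₁.derivedPoint :=
    stub_heegnerNonTorsionAtTwo_pair_of_grossZagier W K (hGZ (W.conductorNorm ℤ) W K) hIQ hHe hr0 hrtw Dt β ι d₁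
  obtain ⟨M₀, hdiv, hndiv⟩ := exists_exactTwoDivisibility_of_not_isOfFinAddOrder W hIQ Dt β ι d₁ hy
  -- the deep witness: free at depth `0`; K₁⁻ empties the `#Sel₂ = 1` cell; on the `#Sel₂ = 4` cell the LEAD g29's frame closers
  -- (WALL row 1 + U₂ + Q2 + PRINT) fed by the steering currency: bit-TRUE ⟹ §3 `…_of_forall_phantom_notMem_selmerGroup`, (α) ⟹ §4 `…_of_alive`
  obtain ⟨n, d, hn, hKoly, hPn⟩ : ∃ (n : ℕ) (d : KolyvaginHeegnerData Dt β ι n), Squarefree n ∧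
      (∀ ℓ ∈ n.primeFactors, Zhang2014.IsKolyvaginPrime (W.conductorNorm ℤ) W K 2 ℓ ∧ 2 ≤ Zhang2014.kolyvaginIndex W 2 ℓ ∧
        FrobEqFrobInfty W K 2 ℓ) ∧
      ¬ ∃ Q : (W.baseChange (ringClassField K ι n)).toAffine.Point, (2 : ℤ) • Q = d.derivedPoint := by
    rcases Nat.eq_zero_or_pos M₀ with hM | hM
    · subst hM
      exact exists_deepWitness_of_depth_zero W Dt β ι d₁ _ hndiv
    · rcases h14 with h1 | h4
      · exact (hK1 W hcm hr0 hρ hT hneg h1 K hIQ hodd h3 hHe hsq1 hsq2 Dt hoptDt hc β ι d₁ hy M₀ hdiv hndiv hM Wd hWd hrd hSel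
          hDEF).elim
      · rcases hAB with hbit | ⟨ξ, hξ0, hξ4, v, 𝔓₀, F, hv, h𝔓₀, hF, hF2, hval⟩
        · exact Summit.BirchSwinnertonDyer.BirchSwinnertonDyer.Theorems.GenusExact.PlusDescent.kFourNeg_conclusion_of_wallRows_U2_of_forall_phantom_notMem_selmerGroup
            hOrd hMult hSS hAdd hTw hQ2 hGZ hGZK hL hMi W hcm hr0 hρ hT hneg h4 K hIQ hodd h3 hHe hsq1 hsq2 ℓ₀ iℓ₀.out hdK h2K Dt
            hoptDt hc β ι d₁ hy M₀ hdiv hndiv hM Wd hWd hrd hSel hDEF hbit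
        · exact Summit.BirchSwinnertonDyer.BirchSwinnertonDyer.Theorems.GenusExact.PlusDescent.kFourNeg_conclusion_of_wallRows_U2_of_alive
            hOrd hMult hSS hAdd hTw hQ2 hGZ hGZK hL hMi W hcm hr0 hρ hT hneg h4 K hIQ hodd h3 hHe hsq1 hsq2 ℓ₀ iℓ₀.out hdK h2K Dt
            hoptDt hc β ι d₁ hy M₀ hdiv hndiv hM Wd hWd hrd hSel hDEF hξ0 hξ4 hv h𝔓₀ hF hF2 hval
  exact ⟨K, iF, iN, hIQ, hodd, h3, hHe, hsq1, hsq2, Dt, β, ι, d₁, hoptDt, hc, hy, M₀, hdiv, hndiv, n, d, hn, hKoly, hPn,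
    Wd, iE, iM, hWd, hcmd, hrd, hSel, hDEF⟩

end Summit.BirchSwinnertonDyer.BirchSwinnertonDyer.Cruxes.GenusDeepSupplyAtTwoNegDiscNarrow.SteeredSupply

end
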